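import Mathlib.RingTheory.IntegralClosure.IntegrallyClosed
import Mathlib.RingTheory.Localization.FractionRing
import Mathlib.RingTheory.IntegralClosure.IsIntegral.Basic
import HarnessLib

/-!
# A linear retract of an integrally closed domain (over which it is integral) is integrally closed

Topic: `Literature/AlgebraicGeometry/Resolution`. A small piece of commutative algebra in the
spirit of the normality of rings of invariants (and of Kato's Thm. (4.1): log regular rings are
normal): let `T → B` be an injective map of domains with `B` integral over `T` and integrally
closed, and suppose there is a `T`-LINEAR retraction `π : B → T` (`π(t · b) = t π(b)`,
`π(t) = t`) — e.g. the Reynolds operator of a finite group of order prime to the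
characteristic, or the projection onto the degree-zero part of a grading by a finite abelian
group (the case of the normalised Kummer cover inside the regular root cover, crux
`PicoverLocalModel`). Then `T` is integrally closed: an element `a/b` of `Frac T` integral over
`T` is integral over `B`, hence equals some `y ∈ B`, i.e. `b y = a`; applying `π`,
`b π(y) = a`, so `a/b = π(y) ∈ T`.

* `IsIntegrallyClosed.of_linear_retraction` — the statement.

Sources: standard (e.g. the proof that a direct summand of a normal domain is normal;
Bruns–Herzog, *Cohen–Macaulay rings*, Prop. 6.4.4 for rings of invariants). Tagged folklore.
-/

namespace Literature.AlgebraicGeometry.Resolution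

/-- **A `T`-linear retract of an integrally closed domain `B`, integral over `T`, is integrally
closed.** Here `T → B` is injective, `B` is an integrally closed domain integral over `T`, and
`π : B →ₗ[T] T` satisfies `π (algebraMap T B t) = t`. [folklore] -/
theorem IsIntegrallyClosed.of_linear_retraction {T B : Type*} [CommRing T] [CommRing B]
    [IsDomain B] [IsIntegrallyClosed B] [Algebra T B] [Algebra.IsIntegral T B]
    (hinj : Function.Injective (algebraMap T B)) (π : B →ₗ[T] T)
    (hπ : ∀ t : T, π (algebraMap T B t) = t) : IsIntegrallyClosed T := by
  haveI : IsDomain T := hinj.isDomain _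
  let K := FractionRing T
  let L := FractionRing B
  -- the induced map of fraction fields
  have hunits : ∀ y : nonZeroDivisors T, IsUnit (algebraMap B L (algebraMap T B y)) := by
    intro y
    refine IsUnit.mk0 _ fun h => nonZeroDivisors.ne_zero y.2 ?_
    exact hinj (by rw [map_zero]; exact (IsFractionRing.injective B L) (by rw [map_zero]; exact h))
  let φ : K →+* L := IsLocalization.lift (M := nonZeroDivisors T)
    (g := (algebraMap B L).comp (algebraMap T B)) hunits
  have hφ : ∀ t : T, φ (algebraMap T K t) = algebraMap B L (algebraMap T B t) := fun t =>
    IsLocalization.lift_eq hunits t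
  refine (isIntegrallyClosed_iff K).mpr fun {z} hz => ?_
  obtain ⟨a, b, hb, rfl⟩ := IsFractionRing.div_surjective (A := T) z
  have hb0 : (b : T) ≠ 0 := nonZeroDivisors.ne_zero hb
  -- `φ z = a / b` in `L` is integral over `B`
  have hzL : IsIntegral B (φ (algebraMap T K a / algebraMap T K b)) := by
    let φₐ : K →ₐ[T] L :=
      { φ with
        commutes' := fun t => by
          change φ (algebraMap T K t) = _
          rw [hφ, IsScalarTower.algebraMap_apply T B L] }
    have h1 : IsIntegral T (φₐ (algebraMap T K a / algebraMap T K b)) := hz.map φₐ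
    exact h1.tower_top
  obtain ⟨y, hy⟩ := IsIntegrallyClosed.algebraMap_eq_of_integral hzL
  -- `b y = a` in `B`
  have hby : algebraMap T B b * y = algebraMap T B a := by
    apply IsFractionRing.injective B L
    rw [map_mul, hy, map_div₀, hφ, hφ, mul_div_cancel₀]
    exact (hunits ⟨b, hb⟩).ne_zero
  -- apply the retraction
  have hba : (b : T) * π y = a := by
    have := congrArg π hby
    rwa [← Algebra.smul_def, map_smul, hπ, smul_eq_mul] at this
  refine ⟨π y, ?_⟩
  rw [eq_div_iff ((map_ne_zero_iff _ (IsFractionRing.injective T K)).mpr hb0), ← map_mul,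
    mul_comm, hba]

end Literature.AlgebraicGeometry.Resolution
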